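import Literature.NumberTheory.DiophantineGeometry.GenEllLCyclic
import Literature.GroupTheory.SpecificGroups.GL2SubgroupContainsSL2
import Literature.GroupTheory.SpecificGroups.SL2PadicSerreLemma
import HarnessLib

/-!
# [GenEll] Lemma 3.1 (iii), (iv) — DISCHARGE of the named facts `GenEll_lemma31_iii`, `GenEll_lemma31_iv`

S. Mochizuki, *Arithmetic elliptic curves in general position*, Math. J. Okayama Univ. **52** (2010),
Lemma 3.1 (iii), (iv), p. 14 [cite: MochizukiGenEll2010, Lem 3.1 (iii) p.14]; (iv) is, as cited there,
[Serre, *Abelian `l`-adic representations*] IV §3.4, Lemma 3 [cite: SerreAbelianLadic1968, IV §3.4 Lemma 3].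

PROOF-ONLY companion of `GenEllLCyclic.lean` (abc-iut-S4, where the two statements are typed as named
facts, D-0014): `GenEll_lemma31_iii_holds : GenEll_lemma31_iii` and
`GenEll_lemma31_iv_holds : GenEll_lemma31_iv`, BY NAME, from the tree's
`Literature.GroupTheory.SpecificGroups.range_toGL_le_of_upperRightHom_one_mem`
(`GL2SubgroupContainsSL2.lean`: `H ≤ GL₂(𝔽_l)` containing `α = (1 1; 0 1)` and a non-upper-triangular
matrix contains `SL₂(𝔽_l)`, for every prime `l`) and
`Literature.GroupTheory.SpecificGroups.range_toGL_le_of_isClosed_of_range_le_map`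
(`SL2PadicSerreLemma.lean`: Serre's lemma for closed subgroups of `SL₂(ℤ_l)`, `l ≥ 5`, and the
commutator argument).  The only glue is `toGL α = upperRightHom 1` (`toGL_sl2Alpha`) and the unfolding
of `IsUpperTriangular M := M 1 0 = 0`.  No definitions, no new named facts.
-/

namespace Literature.NumberTheory.DiophantineGeometry.GenEll

open Matrix Literature.GroupTheory.SpecificGroups

/-- `α = (1 1; 0 1)` of [GenEll] Lemma 3.1 is Mathlib's transvection `U(1)`.
[cite: MochizukiGenEll2010, Lem 3.1 p.14] -/
theorem sl2Alpha_eq_transvection (l : ℕ) [Fact l.Prime] :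
    sl2Alpha (ZMod l) = SpecialLinearGroup.transvection (zero_ne_one : (0 : Fin 2) ≠ 1) (1 : ZMod l) := by
  apply Subtype.ext
  rw [coe_transvection_zero_one]
  rfl

/-- `α = (1 1; 0 1)` of [GenEll] Lemma 3.1, viewed in `GL₂(𝔽_l)`, is Mathlib's `upperRightHom 1`.
[cite: MochizukiGenEll2010, Lem 3.1 p.14] -/
theorem toGL_sl2Alpha (l : ℕ) [Fact l.Prime] :
    SpecialLinearGroup.toGL (sl2Alpha (ZMod l)) = GeneralLinearGroup.upperRightHom (1 : ZMod l) := by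
  rw [sl2Alpha_eq_transvection, toGL_transvection_zero_one]

/-- **[GenEll] Lemma 3.1 (iii) — the named fact `GenEll_lemma31_iii` DISCHARGED** (it holds for every
prime `l`; the hypothesis `5 ≤ l` is not used). [cite: MochizukiGenEll2010, Lem 3.1 (iii) p.14] -/
theorem GenEll_lemma31_iii_holds : GenEll_lemma31_iii := by
  intro l _ _ H hα hβ S
  rw [toGL_sl2Alpha] at hα
  obtain ⟨M, hM, hMut⟩ := hβ
  exact range_toGL_le_of_upperRightHom_one_mem H hα ⟨M, hM, hMut⟩ ⟨S, rfl⟩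

/-- **[GenEll] Lemma 3.1 (iv) — the named fact `GenEll_lemma31_iv` DISCHARGED**: Lemma 3.1 (iii) applied
to the image of `J` in `GL₂(𝔽_l)`, then Serre's lemma ([Serre] IV §3.4 Lemma 3) via
`range_toGL_le_of_isClosed_of_range_le_map`. [cite: MochizukiGenEll2010, Lem 3.1 (iv) p.14] -/
theorem GenEll_lemma31_iv_holds : GenEll_lemma31_iv := by
  intro l _ h5 J hJc hα hβ S
  rw [toGL_sl2Alpha] at hα
  obtain ⟨M, hM, hMut⟩ := hβ
  exact range_toGL_le_of_isClosed_of_range_le_map h5 J hJc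
    (range_toGL_le_of_upperRightHom_one_mem _ hα ⟨M, hM, hMut⟩) ⟨S, rfl⟩

end Literature.NumberTheory.DiophantineGeometry.GenEll
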